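import Literature.MathematicalPhysics.QuantumFieldTheory.Balaban1983to89.B7Prop1Explicit
import HarnessLib

/-!
# NE7AxialRecursionLetters — three elementary letters for the (9)-TYPE HÖLDER REGULARITY of the constrained minimisers (row NE7, gen 111):
# (§1) the two-factor second-difference identity in a normed ring, (§2) first- and second-difference recursions for a sequence `g(t+1) = P(t)·g(t)` of
# contractions (`‖P‖, ‖g‖ ≤ 1`), (§3) the lattice telescope `‖φ(x′) − φ(x)‖ ≤ |x′ − x|₁ · sup ‖φ(p + e_κ) − φ(p)‖` along the tree word

Cell `pub-balaban`, rung (B)+1 sub-cell t4, lineage `b2b-balaban-t4-ne7-p1` (CRUX PROVER NE7 #1 = OWNER of BINDER row NE7), generation 111.  Memo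
`t4/b2b-balaban-t4-ne7-p1-g111/ROAD-G111.md` (the line «(9)-TYPE k-UNIFORM HÖLDER REGULARITY OF EVERY CONSTRAINED SMALL-FIELD MINIMISER, every β < 1»,
ROAD-G110 §NEXT (N2)).  File F1 of five: the algebra consumed by F3 `NE7AxialGaugeDerivatives` (the descending strata induction in the complete axial gauge,
where along a segment in direction `j` the bond variables obey `V₀(z + e_j, ν) = P₀(z; j, ν)·V₀(z, ν)`) and by F4 `NE7AxialGaugePotential` (the Hölder clause
of `TermwiseHolder.HolderReg` from a sup bound on second differences, by telescoping).
WHAT ([folklore]; 0 def, 0 sorry).  §1 `mul_secondDiff_eq`, `norm_mul_secondDiff_le`.  §2 `seq_firstDiff_le` (`‖g′(t) − g(t)‖ ≤ ‖g′(0) − g(0)‖ + t·p₁` when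
`‖P′ − P‖ ≤ p₁`), `seq_secondDiff_le` (the mixed second difference of four such sequences grows by at most `p₂ + p_h·d_v + p_v·d_h` per step).  §3
`norm_sub_le_length_mul` (any word), `norm_sub_le_l1_mul` (the tree word: `‖φ x′ − φ x‖ ≤ l1(x′ − x)·C` once every unit increment `‖φ(p + e_κ) − φ(p)‖ ≤ C`
at the sites `p` with `l1(p − x) ≤ l1(x′ − x) + 1`).
HONEST FRAMING (page 1): elementary normed-ring ∕ lattice bookkeeping; nothing of Bałaban's asserted; NOT NE3∕NE7 as spine nodes; spine 0∕9; finite T⁴ rung (B)+1 —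
NOT infinite volume, NOT mass gap, NOT BetaPertH, NOT Clay (continuum YM on T⁴ ⇐ BetaPertH ∧ nine spine estimates).
-/

set_option autoImplicit false

namespace Summit.QuantumFields.BalabanUV.T4Continuum.NE7AxialRecursionLetters

open Literature.MathematicalPhysics.QuantumFieldTheory.Balaban1983to89
open B7Prop1Explicit

/-! ## §1 The two-factor second difference -/

section Ring

variable {𝔸 : Type*} [NormedRing 𝔸]

/-- **The two-factor second-difference identity**: for the four corner values `A` (base), `B` (shifted in the first direction), `C` (second direction),
`D` (both) of two factors `f`, `g`:
`f_D g_D − f_B g_B − f_C g_C + f_A g_A = (Δ²f)·g_D + (f_B − f_A)(g_D − g_B) + (f_C − f_A)(g_D − g_C) + f_A·(Δ²g)`. [folklore] -/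
theorem mul_secondDiff_eq (fA fB fC fD gA gB gC gD : 𝔸) :
    fD * gD - fB * gB - fC * gC + fA * gA =
      (fD - fB - fC + fA) * gD + (fB - fA) * (gD - gB) + (fC - fA) * (gD - gC) + fA * (gD - gB - gC + gA) := by
  noncomm_ring

/-- **Norm of the two-factor second difference.** [folklore] -/
theorem norm_mul_secondDiff_le {fA fB fC fD gA gB gC gD : 𝔸} {F₂ G₂ fh fv gh gv nf ng : ℝ}
    (h2f : ‖fD - fB - fC + fA‖ ≤ F₂) (h2g : ‖gD - gB - gC + gA‖ ≤ G₂) (hfh : ‖fB - fA‖ ≤ fh) (hfv : ‖fC - fA‖ ≤ fv)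
    (hgv : ‖gD - gB‖ ≤ gv) (hgh : ‖gD - gC‖ ≤ gh) (hgD : ‖gD‖ ≤ ng) (hfA : ‖fA‖ ≤ nf) :
    ‖fD * gD - fB * gB - fC * gC + fA * gA‖ ≤ F₂ * ng + fh * gv + fv * gh + nf * G₂ := by
  rw [mul_secondDiff_eq]
  have hF₂ : 0 ≤ F₂ := (norm_nonneg _).trans h2f
  have hfh0 : 0 ≤ fh := (norm_nonneg _).trans hfh
  have hfv0 : 0 ≤ fv := (norm_nonneg _).trans hfv
  have hnf : 0 ≤ nf := (norm_nonneg _).trans hfA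
  have t1 : ‖(fD - fB - fC + fA) * gD‖ ≤ F₂ * ng := (norm_mul_le _ _).trans (mul_le_mul h2f hgD (norm_nonneg _) hF₂)
  have t2 : ‖(fB - fA) * (gD - gB)‖ ≤ fh * gv := (norm_mul_le _ _).trans (mul_le_mul hfh hgv (norm_nonneg _) hfh0)
  have t3 : ‖(fC - fA) * (gD - gC)‖ ≤ fv * gh := (norm_mul_le _ _).trans (mul_le_mul hfv hgh (norm_nonneg _) hfv0)
  have t4 : ‖fA * (gD - gB - gC + gA)‖ ≤ nf * G₂ := (norm_mul_le _ _).trans (mul_le_mul hfA h2g (norm_nonneg _) hnf)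
  have s1 := norm_add_le ((fD - fB - fC + fA) * gD + (fB - fA) * (gD - gB) + (fC - fA) * (gD - gC)) (fA * (gD - gB - gC + gA))
  have s2 := norm_add_le ((fD - fB - fC + fA) * gD + (fB - fA) * (gD - gB)) ((fC - fA) * (gD - gC))
  have s3 := norm_add_le ((fD - fB - fC + fA) * gD) ((fB - fA) * (gD - gB))
  linarith

/-! ## §2 Products of contractions along a segment: `g(t+1) = P(t)·g(t)` -/

/-- **First differences along the recursion.**  Two sequences `g(t+1) = P(t)g(t)`, `g′(t+1) = P′(t)g′(t)` (`t < m`) of elements of norm `≤ 1` with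
`‖P(t)‖ ≤ 1` and `‖P′(t) − P(t)‖ ≤ p₁`: `‖g′(t) − g(t)‖ ≤ ‖g′(0) − g(0)‖ + t·p₁` for `t ≤ m`. [folklore] -/
theorem seq_firstDiff_le {g g' P P' : ℕ → 𝔸} {m : ℕ} {p₁ : ℝ}
    (hg : ∀ t, t < m → g (t + 1) = P t * g t) (hg' : ∀ t, t < m → g' (t + 1) = P' t * g' t)
    (hP : ∀ t, t < m → ‖P t‖ ≤ 1) (hg'1 : ∀ t, t < m → ‖g' t‖ ≤ 1) (hPP : ∀ t, t < m → ‖P' t - P t‖ ≤ p₁) :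
    ∀ t, t ≤ m → ‖g' t - g t‖ ≤ ‖g' 0 - g 0‖ + t * p₁ := by
  intro t
  induction t with
  | zero => intro _; simp
  | succ t ih =>
    intro ht
    have ht' : t < m := Nat.lt_of_succ_le ht
    have hp₁ : 0 ≤ p₁ := (norm_nonneg _).trans (hPP t ht')
    have hid : g' (t + 1) - g (t + 1) = (P' t - P t) * g' t + P t * (g' t - g t) := by
      rw [hg t ht', hg' t ht']; noncomm_ring
    rw [hid]
    have h1 : ‖(P' t - P t) * g' t‖ ≤ p₁ := by
      refine (norm_mul_le _ _).trans ?_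
      calc ‖P' t - P t‖ * ‖g' t‖ ≤ p₁ * 1 := mul_le_mul (hPP t ht') (hg'1 t ht') (norm_nonneg _) hp₁
        _ = p₁ := mul_one _
    have h2 : ‖P t * (g' t - g t)‖ ≤ ‖g' 0 - g 0‖ + t * p₁ := by
      refine (norm_mul_le _ _).trans ?_
      calc ‖P t‖ * ‖g' t - g t‖ ≤ 1 * (‖g' 0 - g 0‖ + t * p₁) :=
            mul_le_mul (hP t ht') (ih ht'.le) (norm_nonneg _) zero_le_one
        _ = _ := one_mul _
    calc _ ≤ ‖(P' t - P t) * g' t‖ + ‖P t * (g' t - g t)‖ := norm_add_le _ _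
      _ ≤ p₁ + (‖g' 0 - g 0‖ + t * p₁) := add_le_add h1 h2
      _ = ‖g' 0 - g 0‖ + ((t + 1 : ℕ) : ℝ) * p₁ := by push_cast; ring

/-- **Second differences along the recursion.**  Four sequences `g_{ab}(t+1) = P_{ab}(t)·g_{ab}(t)` (`a, b ∈ {0,1}`: base, first shift, second shift, both),
norms `≤ 1`, with `‖Δ²P(t)‖ ≤ p₂`, `‖P₁₀ − P₀₀‖ ≤ p_h`, `‖P₀₁ − P₀₀‖ ≤ p_v` and the first differences of the `g`'s at the far corners `‖g₁₁ − g₁₀‖ ≤ d_v`,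
`‖g₁₁ − g₀₁‖ ≤ d_h`: the mixed second difference `E(t) = g₁₁ − g₁₀ − g₀₁ + g₀₀` obeys `‖E(t)‖ ≤ ‖E(0)‖ + t·(p₂ + p_h d_v + p_v d_h)`. [folklore] -/
theorem seq_secondDiff_le {g₀₀ g₁₀ g₀₁ g₁₁ P₀₀ P₁₀ P₀₁ P₁₁ : ℕ → 𝔸} {m : ℕ} {p₂ ph pv dh dv : ℝ}
    (h₀₀ : ∀ t, t < m → g₀₀ (t + 1) = P₀₀ t * g₀₀ t) (h₁₀ : ∀ t, t < m → g₁₀ (t + 1) = P₁₀ t * g₁₀ t)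
    (h₀₁ : ∀ t, t < m → g₀₁ (t + 1) = P₀₁ t * g₀₁ t) (h₁₁ : ∀ t, t < m → g₁₁ (t + 1) = P₁₁ t * g₁₁ t)
    (hP : ∀ t, t < m → ‖P₀₀ t‖ ≤ 1) (hg : ∀ t, t < m → ‖g₁₁ t‖ ≤ 1)
    (hP2 : ∀ t, t < m → ‖P₁₁ t - P₁₀ t - P₀₁ t + P₀₀ t‖ ≤ p₂)
    (hPh : ∀ t, t < m → ‖P₁₀ t - P₀₀ t‖ ≤ ph) (hPv : ∀ t, t < m → ‖P₀₁ t - P₀₀ t‖ ≤ pv)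
    (hgv : ∀ t, t < m → ‖g₁₁ t - g₁₀ t‖ ≤ dv) (hgh : ∀ t, t < m → ‖g₁₁ t - g₀₁ t‖ ≤ dh) :
    ∀ t, t ≤ m → ‖g₁₁ t - g₁₀ t - g₀₁ t + g₀₀ t‖ ≤ ‖g₁₁ 0 - g₁₀ 0 - g₀₁ 0 + g₀₀ 0‖ + t * (p₂ + ph * dv + pv * dh) := by
  intro t
  induction t with
  | zero => intro _; simp
  | succ t ih =>
    intro ht
    have ht' : t < m := Nat.lt_of_succ_le ht
    have hid : g₁₁ (t + 1) - g₁₀ (t + 1) - g₀₁ (t + 1) + g₀₀ (t + 1)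
        = P₁₁ t * g₁₁ t - P₁₀ t * g₁₀ t - P₀₁ t * g₀₁ t + P₀₀ t * g₀₀ t := by
      rw [h₀₀ t ht', h₁₀ t ht', h₀₁ t ht', h₁₁ t ht']
    rw [hid]
    have hstep := norm_mul_secondDiff_le (hP2 t ht') (ih ht'.le) (hPh t ht') (hPv t ht') (hgv t ht') (hgh t ht') (hg t ht') (hP t ht')
    calc _ ≤ p₂ * 1 + ph * dv + pv * dh + 1 * (‖g₁₁ 0 - g₁₀ 0 - g₀₁ 0 + g₀₀ 0‖ + t * (p₂ + ph * dv + pv * dh)) := hstep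
      _ = ‖g₁₁ 0 - g₁₀ 0 - g₀₁ 0 + g₀₀ 0‖ + ((t + 1 : ℕ) : ℝ) * (p₂ + ph * dv + pv * dh) := by push_cast; ring

end Ring

/-! ## §3 The lattice telescope -/

section Telescope

variable {d : ℕ} {E : Type*} [SeminormedAddCommGroup E]

/-- **Telescoping along a word**: if every unit increment of `φ` met along the word `w` spelled from `x` is bounded by `C`, then
`‖φ(x + disp w) − φ(x)‖ ≤ |w|·C`. [folklore] -/
theorem norm_sub_le_length_mul (φ : Site d → E) (C : ℝ) :
    ∀ (w : List (Letter d)) (x : Site d),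
      (∀ (w₁ w₂ : List (Letter d)) (l : Letter d), w = w₁ ++ l :: w₂ → ‖φ (x + disp w₁ + l.vec) - φ (x + disp w₁)‖ ≤ C) →
      ‖φ (x + disp w) - φ x‖ ≤ w.length * C
  | [], x, _ => by simp
  | l :: w, x, h => by
    have h0 : ‖φ (x + l.vec) - φ x‖ ≤ C := by
      have := h [] w l rfl
      simpa using this
    have ih := norm_sub_le_length_mul φ C w (x + l.vec) (fun w₁ w₂ l' hw => by
      have := h (l :: w₁) w₂ l' (by rw [hw]; rfl)
      rwa [disp_cons, ← add_assoc] at this)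
    rw [disp_cons, ← add_assoc, List.length_cons, Nat.cast_succ, add_mul, one_mul]
    calc ‖φ (x + l.vec + disp w) - φ x‖ = ‖(φ (x + l.vec + disp w) - φ (x + l.vec)) + (φ (x + l.vec) - φ x)‖ := by rw [sub_add_sub_cancel]
      _ ≤ ‖φ (x + l.vec + disp w) - φ (x + l.vec)‖ + ‖φ (x + l.vec) - φ x‖ := norm_add_le _ _
      _ ≤ w.length * C + C := add_le_add ih h0

/-- **The lattice telescope along the tree word**: if `‖φ(p + e_κ) − φ(p)‖ ≤ C` at every site `p` with `l1(p − x) ≤ l1(x′ − x) + 1` and every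
direction `κ`, then `‖φ(x′) − φ(x)‖ ≤ l1(x′ − x)·C`. [folklore] -/
theorem norm_sub_le_l1_mul (φ : Site d → E) {C : ℝ} (x x' : Site d)
    (h : ∀ (p : Site d) (κ : Fin d), l1 (p - x) ≤ l1 (x' - x) + 1 → ‖φ (p + e κ) - φ p‖ ≤ C) :
    ‖φ x' - φ x‖ ≤ l1 (x' - x) * C := by
  have hmain := norm_sub_le_length_mul φ C (treeWord (x' - x)) x ?_
  · rwa [disp_treeWord, add_sub_cancel, length_treeWord] at hmain
  intro w₁ w₂ l hw
  -- the prefix point `p = x + disp w₁` is within `|w₁| ≤ l1(x′ − x)` of `x`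
  have hlen : w₁.length ≤ l1 (x' - x) := by
    have := congrArg List.length hw
    rw [length_treeWord, List.length_append, List.length_cons] at this
    omega
  have hp : l1 (x + disp w₁ - x) ≤ l1 (x' - x) := by
    rw [add_sub_cancel_left]; exact (l1_disp_le w₁).trans hlen
  obtain ⟨κ, b⟩ := l
  cases b
  · -- backward letter: the increment from `q = p − e_κ` to `q + e_κ = p`
    have hq : l1 (x + disp w₁ + -e κ - x) ≤ l1 (x' - x) + 1 := by
      have e1 : x + disp w₁ + -e κ - x = (x + disp w₁ - x) + Letter.vec ((κ, false) : Letter d) := by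
        simp only [Letter.vec_false]; abel
      rw [e1]
      exact (l1_add_le _ _).trans (by rw [l1_vec]; omega)
    have := h (x + disp w₁ + -e κ) κ hq
    rw [show x + disp w₁ + -e κ + e κ = x + disp w₁ by abel] at this
    rw [Letter.vec_false, ← norm_neg, neg_sub]
    exact this
  · rw [Letter.vec_true]
    exact h (x + disp w₁) κ (hp.trans (Nat.le_succ _))

end Telescope

end Summit.QuantumFields.BalabanUV.T4Continuum.NE7AxialRecursionLetters
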